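import Literature.MathematicalPhysics.QuantumFieldTheory.Balaban1983to89.B3Ineq210RegularRegion

/-!
# Bałaban, *(Higgs)₂,₃ quantum fields in a finite volume III. Renormalization* [B3] — (2.12) p. 426, THE AVERAGED-VECTOR-LEG
MEMBER OF THE SCALE PIECES, `|G^η_{(j)}(Γ^{(j+1)}_{x_{j+1},x}, b)| ≤ O(1)(L^jη)^{−d+3}e^{−δ₁(L^jη)^{−1}dist(B^j(x),b)}`, ON A REGION `Ω ⊊ T_η`
(a union of big blocks), AT BLOCK-INTERIOR POINTS, PROVED for a concrete carrier of `B3Sect2StatementsPart2.ScaledKernels` (the decl of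
record `ScaledKernels.Ineq212 δ₁ C` of row B3.Eq2.12 DISCHARGED), together with (2.10) on the same carrier

statement-level skeleton of published theorems with citation tags; proofs where landed; nothing here is a claim about the Yang–Mills mass gap

T. Bałaban, Commun. Math. Phys. **88** (1983) 411–445 [cite: Balaban1983Higgs3]; inputs from part I, Commun. Math. Phys. **85** (1982)
603–636 [cite: Balaban1982Higgs1] as landed in the tree.  PDF held: `paper:balaban1983-higgs-2-3-quantum-fields-finite-volume` (journal page
= PDF page + 410), p. 426 [PDF 16] (OCR `p0016.txt`, render `run/shared/lean/pub/pub-balaban/b2b-balaban-ref1/pages/1983-cmp88-higgs23-III/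
1983-cmp88-higgs23-III-p016-x2.png`, both re-read by this seat's lineage, gen 32).

CITATION HEADER (lean-in-tree rule).  Cell `lit-balaban` (HOME `run/shared/lean/pub/lit-balaban/`), Phase-2 proof seat **p26** gen 33
(unit `lit-balaban-p26`; TAKING line HOME/STATUS.md 2026-08-22T20:58Z); SKELETON row **B3.Eq2.12** (fold owner r15; DECL OF RECORD
`B3Sect2StatementsPart2.ScaledKernels.Ineq212`, typed p239134; proved members so far: p03 g4's MODEL INSTANCES `B3Ineq212ZeroBox`
(p254210, Neumann boxes) and `B3Ineq212ZeroTorus` (p259522, the whole torus `T_η`); r15's `B3-CLOSURE.md` §5 after v1.9: «what remains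
for (2.12) is the region generality»).  The REGION member, built on r14 g17's `B3Ineq210RegularRegion` (p340643: (2.10) on a big-block
region at interior points — the region pieces `pieceR`, the interior predicate `Interior`, the un-subtyped theorem
`ineq210_regularRegion_explicit`) and on the tree's own composite contours of [B1] (2.1)–(2.2) (`HiggsAveraging.shiftN`/`toFinest`/
`blockIter`, p17's corners `B2Restr216Lattice.cornerN`, p23's geometry `B2Ineq329PrismHolonomy.blockIter_stair_src` (the bonds of
`Γ^{(n)}_{x_n,x}` start in `B^n(x)`) and `sum_steps_le` (its length is `≤ d(L^n − 1)`)).  USED BY NAME, never restated: those,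
`B1Cor23ZeroFieldRegion.tdist_le_of_blockIter_eq_real` (a `k`-fold block has diameter `≤ L^k − 1`), `B1Ineq234LevelZero.tdist_comm`/
`tdist_triangle_real`, `B3Ineq210RegularTorus.mesh_eq_pow_mul`.

## What is printed (p. 426 [PDF 16], verbatim)

*"If a leg A′ of the line is in one of the vertices (1.14) and (1.15), then we have the expression A′^{(j),η}(Γ^{j+1}_{x_{j+1},x}) on the
basis of (1.3). For each such expression we have an additional factor L^jη on the right side, e.g. we have
|G^η_{(j)}(Γ^{(j+1)}_{x_{j+1},x}, b)| ≤ O(1)(L^jη)^{−d+3}e^{−δ₁(L^jη)^{−1}dist(B^j(x),b)}. (2.12) These inequalities will be used in the next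
chapter. They all are obtained by rescaling from the η-lattice to the L^{−j}-lattice and application of Propositions I.2.1 and I.2.3."*
[B1] p. 608: *"Γ_{y,x} = ⟨y, (y₁, …, y_{d−1}, x_d)⟩ ∪ … ∪ ⟨(y₁, x₂, …, x_d), x⟩ … (2.1)"*, *"Γ^{(k)}_{y,x} = Γ_{y,x_{k−1}} ∪ Γ_{x_{k−1},x_{k−2}}
∪ … ∪ Γ_{x_1,x} (2.2)"*, and *"The renormalization transformations for vector fields will be obtained by taking N = d and an external vector
field A = 0"* — the averaged kernels of (2.12) are VECTOR-field pieces, so NO background `B̃` enters them (reading note of record at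
`HOME/lit-balaban-r15/ROWS-B3.md` B3.Eq2.12, v1.167, with the owner's agreement); I p. 610, Proposition 2.1: the inequalities hold for
`x, x′ ∈ Ω` with «dist({x,x′}, Ωᶜ) ≥ R₀».

## What this file proves (`ineq212_regularRegion`), and how

§1 the composite contour `Γ^{(n)}_{x_n,x}` of [B1] (2.2) as a FINITE SET OF FINE BONDS `(base point, direction)` on `T_ε` (`stairBase`,
`stairBondsR`, `contourBondsR`) in the vocabulary of `HiggsAveraging.multiContourSum` (corners `cornerN (toFinest (blockIter (i+1) x))
(toFinest (blockIter i x)) (ν+1)`, straight shifts `shiftN`), with `mem_contourBondsR`, **`card_contourBondsR_le`** (`#Γ^{(n)}_{x_n,x} ≤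
d(L^n − 1)`, p23's `sum_steps_le`), **`blockIter_of_mem_contourBondsR`** (every bond starts in `B^k(x)` for `n ≤ k ≤ K`, p23's
`blockIter_stair_src`) and `tdist_of_mem_contourBondsR_le` (the base points are within `L^n − 1` of `x`); §1.1 the dictionary lemma
**`sum_contourBondsR_eq_multiContourSum`** — the bond set IS the contour of the tree: for every bond function `B`, `Σ_{(p,ν) ∈ contourBondsR n x}
B_{⟨p,ν⟩} = HiggsAveraging.multiContourSum B n x = B(Γ^{(n)}_{x_n,x})` (the bonds are pairwise distinct: running labels in disjoint windows,
`val_stairBase`, `disjoint_stairBondsR`); §2 the averaged vector leg: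
`vecPieceR` (`δ_{νμ}·G^η_{(j)}(Ω, 0; z, x_b)e_{i′}` — the region pieces of r14 g17 AT ZERO BACKGROUND, the `N` colour columns), `gsumR`
(`Σ_{b′ ⊂ Γ^{(j+1)}_{x_{j+1},x}} ε·δ_{ν(b′)μ(b)}G^η_{(j)}(Ω, 0; z(b′), x_b)e_{i′}` — the leg `A′^{(j),η}(Γ^{(j+1)}_{x_{j+1},x}) = Σ_{b′⊂Γ}ηA′_{b′}` of (1.3)
contracted with `A′_b`), the block distance `distBlockR j x b = ε·dist(B^j(x), b)` (`distBlockR_le`: `≤ ε|x − x_b|`), and the ENGINE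
**`absGavg_le_of_pointwise`**: a (2.10)-type value bound at the base points of the contour gives the (2.12) bound with «an additional
factor L^jη» (at most `d·L^{j+1}` bonds of weight `ε`, `ε·d·L^{j+1} = dL·(L^jε)`; the spread of the contour costs `e^{δ₁L}`); §3 the
block-interior predicate `BlockInterior k K₀ Ω x` (EVERY point of the `k`-block `B^k(x)` is r14's `Interior` point — the contour
`Γ^{(j+1)}_{x_{j+1},x} ⊂ B^{j+1}(x) ⊆ B^k(x)` must carry Proposition I.2.1's `R₀`-margin), `blockInterior_of_ball` (a ball of radius
`margin + L^k − 1` inside `Ω` suffices), `blockInterior_univ`; the carrier `regRegionKernelsV` and the transfer lemmas `ineq210_of_boundsV`,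
`ineq212_of_boundV`; §4 the theorems: **`ineq212_regularRegion`** (the decl of record `Ineq212 δ₁ C` inhabited), `ineq210_and_212_regularRegionV`
((2.10) ∧ (2.12) on the same carrier, same constants), the un-subtyped explicit form `ineq212_regularRegion_explicit`, and the case
`Ω = T_ε` (`ineq212_regularRegion_univ`: a torus member for EVERY `L ≥ 2`, no parity — p03's torus member p259522 has `L` odd, zero
background for the scalar lines and no charge / cube-tiling hypotheses); §5 non-vacuity with a PROPER region:
`blockInterior_hypotheses_nonvacuous` (r14 g17's slab of cells with the margin widened by the block diameter `L − 1`; a block-interior point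
at every admissible cube size `K₀ ≥ K₀,min`, the field hypotheses at `A = 0`).

## Dictionary and honest scope

`T_η ⊃ Ω`, `η = ε`; carrier `Site := {x ∈ T_ε // BlockInterior k K₀ Ω x}`, `Bond := Site × directions` (positively oriented fine bonds
`b = ⟨x_b, x_b + εe_μ⟩` with block-interior base point); `dist = ε|x − x′|`; the SCALAR-line fields `absG`/`absDG` are r14 g17's region
kernels `ε^{−d}Σ_{i′}‖(G^η_{(j)}(Ω,A)e_{(x′,i′)})(x)‖` at the regular background `A` and their covariant derivatives (restricted from interior to
block-interior points, nothing else changed); the VECTOR-line field `absGavg j x b = ε^{−d}Σ_{i′}‖Σ_{b′ ⊂ Γ^{(j+1)}_{x_{j+1},x}} ε·δ_{ν(b′)μ(b)}·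
(G^η_{(j)}(Ω,0)e_{(x_b,i′)})(z(b′))‖` — the SAME column-sum norm as `absG`, applied to the contour-summed kernel of the pieces at `A = 0`
(print: `N = d` colour components, which at `A = 0` are `N` decoupled copies of the one-component kernel; the selector `δ_{νμ}` is p03
g4's reading of the vector propagator, as in `B3Ineq212ZeroBox`/`B3Ineq212ZeroTorus`); `distBlock j x b = ε·min_{z ∈ B^j(x)} min(|z − x_b|,
|z − (x_b + e_μ)|)`.  The (2.5)/(2.11) fields stay un-modelled (`0`; nothing is claimed about them; (2.11) on regions is p35 g16's
`B3Ineq211RegularRegion` on r14's site type).  NOT covered: points whose `k`-block meets the margin strip of `Ω`; `m² = 0`; regions that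
are not unions of `L^kK₀`-cells; volumes with `K₀ ∤ M` or fewer than three cells a side at scale `k` (`3L^kK₀ ≤ |T_ε|_μ`); charges with
`e² > E₀` (the packaging of «e(L^kε) sufficiently small» in r14 g14's region form of (I.2.34) — inherited through `ineq210_regularRegion_explicit`
although the vector pieces at `A = 0` do not see the charge); the constants depend on `K₀` and are chosen after the charge data
(quantifier shape of the inputs).  NO PARITY CONDITION ON `L` (`L ≥ 2`).  No `def … : Prop` fact, no new named fact (`stairBase`,
`stairBondsR`, `contourBondsR`, `vecPieceR`, `gsumR`, `distBlockR`, `BlockInterior`, `regRegionKernelsV` are concrete `def`s; the theorems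
are proved); standard axioms.  Value = kernel certificate of a located by-reference step of B3 on the paper's own lattice for regions,
NOT summit progress.
-/

noncomputable section

open scoped BigOperators

namespace Literature.MathematicalPhysics.QuantumFieldTheory.Balaban1983to89.B3Ineq212RegularRegion

open HiggsLattice (ChargeData ScalarField covDeriv)
open HiggsAveraging (blockIter blockK mem_blockK toFinest shiftN)
open B1Eq230FluctCov (Ix cb)
open B2Restr216Lattice (cornerN)
open B2Ineq329PrismHolonomy (blockIter_stair_src sum_steps_le val_toFinest_blockIter val_steps corner_eq_cornerN)
open B2Ineq329ZeroAveraging (val_shiftN)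
open HiggsAveraging (multiContourSum contourSum segSum corner)
open B3Sect2StatementsPart2 (ScaledKernels)
open B1TorusCubeCover (half)
open B1TorusCubeLocality26 (rS)
open B1TorusRegionHSizes (IsBigBlockUnion isBigBlockUnion_univ)
open B3Ineq210RegularTorus (mesh_eq_pow_mul)
open B3Ineq210RegularRegion (Interior pieceR pieceR_of_le ineq210_regularRegion_explicit)
open B1Cor23ZeroFieldRegion (tdist_le_of_blockIter_eq_real)
open B1Ineq234LevelZero (tdist_comm tdist_triangle_real)

variable {P : HiggsLattice.Params} {N : ℕ}

/-! ## §1 The composite contour `Γ^{(n)}_{x_n,x}` of [Balaban1982Higgs1] (2.1)–(2.2) as a finite set of fine bonds of `T_ε` -/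

section Contour

variable (P)

/-- The number `m_{i,ν}` of fine bonds of direction `ν` on the staircase `Γ_{x_{i+1},x_i}` of [B1] (2.1)–(2.2): the difference of the corner
labels `Lⁱ⌊x_ν/Lⁱ⌋ − Lⁱ⁺¹⌊x_ν/Lⁱ⁺¹⌋` (as in `HiggsAveraging.contourSum`, `(X ν − Y ν).val` with `Y = x̃_{i+1}`, `X = x̃_i`).
[cite: Balaban1982Higgs1, (2.1)–(2.2) p.608] -/
def nstepsR (i : ℕ) (x : HiggsLattice.Site P 0) (ν : Fin P.d) : ℕ :=
  ((toFinest (blockIter i x)) ν - (toFinest (blockIter (i + 1) x)) ν).val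

/-- The base point of the `s`-th bond of direction `ν` of the staircase `Γ_{x_{i+1},x_i}` of [B1] (2.1): `cornerN x̃_{i+1} x̃_i (ν+1) + sεe_ν`
in the tree's corner convention `B2Restr216Lattice.cornerN` (coordinates `≤ ν` still those of the start corner `x̃_{i+1}`, coordinates `> ν`
already those of the end point `x̃_i` — (2.1) moves the last coordinate first —, then `s` steps in direction `ν`); this is the bond family of
`B2Ineq329PrismHolonomy.abs_multiContourSum_le`. [cite: Balaban1982Higgs1, (2.1)–(2.2) p.608] -/
def stairBase (i : ℕ) (x : HiggsLattice.Site P 0) (ν : Fin P.d) (s : ℕ) : HiggsLattice.Site P 0 :=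
  shiftN (cornerN (toFinest (blockIter (i + 1) x)) (toFinest (blockIter i x)) (ν + 1)) ν s

/-- The staircase `Γ_{x_{i+1},x_i}` of [B1] (2.1), verbatim: *"Γ_{y,x} = ⟨y, (y₁, …, y_{d−1}, x_d)⟩ ∪ … ∪ ⟨(y₁, x₂, …, x_d), x⟩ … Each such
contour is composed of the bonds of ε-lattice"*, as a set of positively oriented fine bonds `(base point, direction)`.
[cite: Balaban1982Higgs1, (2.1) p.608] -/
def stairBondsR (i : ℕ) (x : HiggsLattice.Site P 0) : Finset (HiggsLattice.Site P 0 × Fin P.d) :=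
  Finset.univ.biUnion fun ν : Fin P.d => (Finset.range (nstepsR P i x ν)).image fun s => (stairBase P i x ν s, ν)

/-- The composite contour `Γ^{(n)}_{x_n,x} = Γ_{x_n,x_{n−1}} ∪ … ∪ Γ_{x_1,x}` of [B1] (2.2) (`x_0 = x`), as a set of fine bonds of `T_ε` — the bond
set summed over by `HiggsAveraging.multiContourSum · n x`. [cite: Balaban1982Higgs1, (2.2) p.608] -/
def contourBondsR (n : ℕ) (x : HiggsLattice.Site P 0) : Finset (HiggsLattice.Site P 0 × Fin P.d) :=
  (Finset.range n).biUnion fun i => stairBondsR P i x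

variable {P}

/-- The bonds of `Γ^{(n)}_{x_n,x}`, by construction. [cite: Balaban1982Higgs1, (2.1)–(2.2) p.608] -/
theorem mem_contourBondsR {n : ℕ} {x : HiggsLattice.Site P 0} {b : HiggsLattice.Site P 0 × Fin P.d} (hb : b ∈ contourBondsR P n x) :
    ∃ i, i < n ∧ ∃ (ν : Fin P.d) (s : ℕ), s < nstepsR P i x ν ∧ b = (stairBase P i x ν s, ν) := by
  unfold contourBondsR at hb
  rw [Finset.mem_biUnion] at hb
  obtain ⟨i, hi, hb⟩ := hb
  unfold stairBondsR at hb
  rw [Finset.mem_biUnion] at hb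
  obtain ⟨ν, -, hb⟩ := hb
  rw [Finset.mem_image] at hb
  obtain ⟨s, hs, rfl⟩ := hb
  exact ⟨i, Finset.mem_range.1 hi, ν, s, Finset.mem_range.1 hs, rfl⟩

/-- The number of bonds is at most the sum of the step counts `Σ_{i<n} Σ_ν m_{i,ν}`. [cite: Balaban1982Higgs1, (2.2) p.608] -/
theorem card_contourBondsR_le_sum (n : ℕ) (x : HiggsLattice.Site P 0) :
    (contourBondsR P n x).card ≤ ∑ i ∈ Finset.range n, ∑ ν : Fin P.d, nstepsR P i x ν := by
  unfold contourBondsR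
  refine Finset.card_biUnion_le.trans (Finset.sum_le_sum fun i _ => ?_)
  unfold stairBondsR
  refine Finset.card_biUnion_le.trans (Finset.sum_le_sum fun ν _ => ?_)
  exact Finset.card_image_le.trans (by rw [Finset.card_range])

/-- **THE NUMBER OF BONDS of `Γ^{(n)}_{x_n,x}` is at most `d·(L^n − 1)`** (p23's `sum_steps_le`: direction by direction the staircases telescope)
— the source of «an additional factor L^jη» in (2.12). [cite: Balaban1983Higgs3, (2.12) p.426] [cite: Balaban1982Higgs1, (2.2) p.608] -/
theorem card_contourBondsR_le {n : ℕ} (hn : n ≤ P.K) (x : HiggsLattice.Site P 0) :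
    ((contourBondsR P n x).card : ℝ) ≤ P.d * ((P.L : ℝ) ^ n - 1) := by
  have h1 : ((contourBondsR P n x).card : ℝ) ≤ ((∑ i ∈ Finset.range n, ∑ ν : Fin P.d, nstepsR P i x ν : ℕ) : ℝ) := by
    exact_mod_cast card_contourBondsR_le_sum n x
  refine h1.trans ?_
  rw [Nat.cast_sum]
  simp_rw [Nat.cast_sum]
  exact sum_steps_le hn x

/-- **Every bond of `Γ^{(n)}_{x_n,x}` starts in the block `B^k(x)`** for `n ≤ k ≤ K` (p23's `blockIter_stair_src`).
[cite: Balaban1982Higgs1, (2.2) p.608] -/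
theorem blockIter_of_mem_contourBondsR {n k : ℕ} (hnk : n ≤ k) (hk : k ≤ P.K) {x : HiggsLattice.Site P 0}
    {b : HiggsLattice.Site P 0 × Fin P.d} (hb : b ∈ contourBondsR P n x) : blockIter k b.1 = blockIter k x := by
  obtain ⟨i, hi, ν, s, hs, rfl⟩ := mem_contourBondsR hb
  exact blockIter_stair_src (lt_of_lt_of_le hi hnk) hk x ν hs

/-- **The base points of the bonds of `Γ^{(n)}_{x_n,x}` are within `L^n − 1` of `x`** (torus distance (I.1.3), fine units; `n ≤ K`): they
share the block `B^n(x)`, whose diameter is `≤ L^n − 1` (`B1Cor23ZeroFieldRegion.tdist_le_of_blockIter_eq_real`).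
[cite: Balaban1982Higgs1, (2.2) p.608] -/
theorem tdist_of_mem_contourBondsR_le {n : ℕ} (hn : n ≤ P.K) {x : HiggsLattice.Site P 0} {b : HiggsLattice.Site P 0 × Fin P.d}
    (hb : b ∈ contourBondsR P n x) : (HiggsLattice.Site.tdist b.1 x : ℝ) ≤ (P.L : ℝ) ^ n - 1 :=
  tdist_le_of_blockIter_eq_real hn (blockIter_of_mem_contourBondsR le_rfl hn hb)

/-! ### §1.1 The bond set is the composite contour of `HiggsAveraging.multiContourSum` (the bonds are pairwise distinct) -/

/-- kernel: `Lⁱ⌊v/Lⁱ⌋ ≤ v`. [folklore] -/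
private theorem cl_le (v m : ℕ) : v / m * m ≤ v := Nat.div_mul_le_self v m

/-- kernel: the corner labels decrease with the level, `Lᵏ⌊v/Lᵏ⌋ ≤ Lⁱ⌊v/Lⁱ⌋` for `i ≤ k`. [folklore] -/
private theorem cl_mono {i k : ℕ} (hik : i ≤ k) (v : ℕ) : v / P.L ^ k * P.L ^ k ≤ v / P.L ^ i * P.L ^ i := by
  have hdvd : P.L ^ i ∣ v / P.L ^ k * P.L ^ k := Dvd.dvd.mul_left (pow_dvd_pow P.L hik) _
  calc v / P.L ^ k * P.L ^ k = (v / P.L ^ k * P.L ^ k) / P.L ^ i * P.L ^ i := (Nat.div_mul_cancel hdvd).symm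
    _ ≤ v / P.L ^ i * P.L ^ i := Nat.mul_le_mul_right _ (Nat.div_le_div_right (cl_le v _))

/-- The step count is the difference of consecutive corner labels: `m_{i,ν} = Lⁱ⌊x_ν/Lⁱ⌋ − Lⁱ⁺¹⌊x_ν/Lⁱ⁺¹⌋` (`i + 1 ≤ K`; p23's `val_steps`).
[cite: Balaban1982Higgs1, (2.2) p.608] -/
theorem nstepsR_eq {i : ℕ} (hi : i + 1 ≤ P.K) (x : HiggsLattice.Site P 0) (ν : Fin P.d) :
    nstepsR P i x ν = (x ν).val / P.L ^ i * P.L ^ i - (x ν).val / P.L ^ (i + 1) * P.L ^ (i + 1) :=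
  val_steps hi x ν

/-- **The running label of the base point**: `(stairBase i x ν s)_ν = Lⁱ⁺¹⌊x_ν/Lⁱ⁺¹⌋ + s` for `s < m_{i,ν}` (no wrap-around: the label stays
below `Lⁱ⌊x_ν/Lⁱ⌋ ≤ x_ν`). [cite: Balaban1982Higgs1, (2.1)–(2.2) p.608] -/
theorem val_stairBase {i : ℕ} (hi : i + 1 ≤ P.K) (x : HiggsLattice.Site P 0) (ν : Fin P.d) {s : ℕ} (hs : s < nstepsR P i x ν) :
    ((stairBase P i x ν s) ν).val = (x ν).val / P.L ^ (i + 1) * P.L ^ (i + 1) + s := by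
  rw [nstepsR_eq hi] at hs
  unfold stairBase
  rw [val_shiftN]
  have hc : ((cornerN (toFinest (blockIter (i + 1) x)) (toFinest (blockIter i x)) (ν + 1)) ν).val
      = (x ν).val / P.L ^ (i + 1) * P.L ^ (i + 1) := by
    simp only [cornerN, Nat.lt_succ_self, if_true]
    exact val_toFinest_blockIter hi x ν
  rw [hc]
  have hlt : (x ν).val / P.L ^ (i + 1) * P.L ^ (i + 1) + s < P.sitesPerDir 0 ν := by
    have := cl_le (x ν).val (P.L ^ i)
    have := ZMod.val_lt (x ν)
    omega
  exact Nat.mod_eq_of_lt hlt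

/-- The running label stays below the next corner label: `Lⁱ⁺¹⌊x_ν/Lⁱ⁺¹⌋ + s < Lⁱ⌊x_ν/Lⁱ⌋` for `s < m_{i,ν}`.
[cite: Balaban1982Higgs1, (2.1)–(2.2) p.608] -/
theorem val_stairBase_lt {i : ℕ} (hi : i + 1 ≤ P.K) (x : HiggsLattice.Site P 0) (ν : Fin P.d) {s : ℕ} (hs : s < nstepsR P i x ν) :
    ((stairBase P i x ν s) ν).val < (x ν).val / P.L ^ i * P.L ^ i := by
  rw [val_stairBase hi x ν hs]
  rw [nstepsR_eq hi] at hs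
  omega

/-- Within one direction of one staircase the base points are pairwise distinct. [cite: Balaban1982Higgs1, (2.1) p.608] -/
theorem stairBase_injOn {i : ℕ} (hi : i + 1 ≤ P.K) (x : HiggsLattice.Site P 0) (ν : Fin P.d) :
    Set.InjOn (fun s => (stairBase P i x ν s, ν)) ↑(Finset.range (nstepsR P i x ν)) := by
  intro s hs s' hs' h
  have hs := Finset.mem_range.1 (Finset.mem_coe.1 hs)
  have hs' := Finset.mem_range.1 (Finset.mem_coe.1 hs')
  have h1 : ((stairBase P i x ν s) ν).val = ((stairBase P i x ν s') ν).val := by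
    have := congrArg Prod.fst h
    simp only at this
    rw [this]
  rw [val_stairBase hi x ν hs, val_stairBase hi x ν hs'] at h1
  omega

/-- Bonds of different levels of `Γ^{(n)}_{x_n,x}` are distinct (`i < i′`, both `< K`): in the common direction `ν` the running labels lie in the
disjoint windows `[Lⁱ⁺¹⌊x_ν/Lⁱ⁺¹⌋, Lⁱ⌊x_ν/Lⁱ⌋)` and `[Lⁱ′⁺¹⌊x_ν/Lⁱ′⁺¹⌋, Lⁱ′⌊x_ν/Lⁱ′⌋)`. [cite: Balaban1982Higgs1, (2.2) p.608] -/
theorem stairBase_ne_of_lt {i i' : ℕ} (hii' : i < i') (hi' : i' + 1 ≤ P.K) (x : HiggsLattice.Site P 0) (ν : Fin P.d) {s s' : ℕ}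
    (hs : s < nstepsR P i x ν) (hs' : s' < nstepsR P i' x ν) : stairBase P i x ν s ≠ stairBase P i' x ν s' := by
  intro h
  have hi : i + 1 ≤ P.K := by omega
  have h1 : ((stairBase P i x ν s) ν).val = ((stairBase P i' x ν s') ν).val := by rw [h]
  have hlt := val_stairBase_lt hi' x ν hs'
  rw [val_stairBase hi x ν hs] at h1
  have hmono : (x ν).val / P.L ^ i' * P.L ^ i' ≤ (x ν).val / P.L ^ (i + 1) * P.L ^ (i + 1) := cl_mono (by omega) _
  omega

/-- The staircases of different levels are disjoint bond sets. [cite: Balaban1982Higgs1, (2.2) p.608] -/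
theorem disjoint_stairBondsR {i i' : ℕ} (hne : i ≠ i') (hi : i + 1 ≤ P.K) (hi' : i' + 1 ≤ P.K) (x : HiggsLattice.Site P 0) :
    Disjoint (stairBondsR P i x) (stairBondsR P i' x) := by
  rw [Finset.disjoint_left]
  intro b hb hb'
  unfold stairBondsR at hb hb'
  rw [Finset.mem_biUnion] at hb hb'
  obtain ⟨ν, -, hb⟩ := hb
  obtain ⟨ν', -, hb'⟩ := hb'
  rw [Finset.mem_image] at hb hb'
  obtain ⟨s, hs, rfl⟩ := hb
  obtain ⟨s', hs', h⟩ := hb'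
  have hνν : ν' = ν := congrArg Prod.snd h
  subst hνν
  have h1 : stairBase P i' x ν' s' = stairBase P i x ν' s := congrArg Prod.fst h
  rcases Nat.lt_or_gt_of_ne hne with hlt | hgt
  · exact stairBase_ne_of_lt hlt hi' x ν' (Finset.mem_range.1 hs) (Finset.mem_range.1 hs') h1.symm
  · exact stairBase_ne_of_lt hgt hi x ν' (Finset.mem_range.1 hs') (Finset.mem_range.1 hs) h1

/-- The sum of a bond function over one staircase is `HiggsAveraging.contourSum` between the consecutive block corners.
[cite: Balaban1982Higgs1, (2.1), (2.3) p.608] -/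
theorem sum_stairBondsR_eq_contourSum {i : ℕ} (hi : i + 1 ≤ P.K) (B : HiggsLattice.VecField P 0) (x : HiggsLattice.Site P 0) :
    ∑ b ∈ stairBondsR P i x, B ⟨b.1, b.2⟩
      = contourSum B (toFinest (blockIter (i + 1) x)) (toFinest (blockIter i x)) := by
  unfold stairBondsR contourSum
  rw [Finset.sum_biUnion]
  · refine Finset.sum_congr rfl fun ν _ => ?_
    rw [Finset.sum_image (stairBase_injOn hi x ν)]
    unfold segSum
    rw [corner_eq_cornerN]
    rfl
  · intro ν _ ν' _ hνν'
    rw [Function.onFun, Finset.disjoint_left]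
    intro b hb hb'
    rw [Finset.mem_image] at hb hb'
    obtain ⟨s, -, rfl⟩ := hb
    obtain ⟨s', -, h⟩ := hb'
    exact hνν' (congrArg Prod.snd h).symm

/-- **THE BOND SET IS THE COMPOSITE CONTOUR OF THE TREE**: for every bond function `B` and `n ≤ K`,
`Σ_{(p,ν) ∈ contourBondsR n x} B_{⟨p,ν⟩} = B(Γ^{(n)}_{x_n,x})` = `HiggsAveraging.multiContourSum B n x` (the bonds `(stairBase i x ν s, ν)`, `i < n`,
`s < m_{i,ν}`, are pairwise distinct) — so `gsumR` below is the functional `A′ ↦ A′^{(j),η}(Γ^{(j+1)}_{x_{j+1},x}) = Σ_{b′⊂Γ}ηA′_{b′}` of (1.3)/(I.2.3)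
applied column by column to the kernel. [cite: Balaban1982Higgs1, (2.2)–(2.3) p.608] [cite: Balaban1983Higgs3, (1.3) p.412] -/
theorem sum_contourBondsR_eq_multiContourSum {n : ℕ} (hn : n ≤ P.K) (B : HiggsLattice.VecField P 0) (x : HiggsLattice.Site P 0) :
    ∑ b ∈ contourBondsR P n x, B ⟨b.1, b.2⟩ = multiContourSum B n x := by
  unfold contourBondsR multiContourSum
  rw [Finset.sum_biUnion]
  · exact Finset.sum_congr rfl fun i hi => sum_stairBondsR_eq_contourSum (by have := Finset.mem_range.1 hi; omega) B x
  · intro i hi i' hi' hne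
    exact disjoint_stairBondsR hne (by have := Finset.mem_range.1 (Finset.mem_coe.1 hi); omega)
      (by have := Finset.mem_range.1 (Finset.mem_coe.1 hi'); omega) x

end Contour

/-! ## §2 The averaged vector leg `G^η_{(j)}(Γ^{(j+1)}_{x_{j+1},x}, b)` on a region and the block distance `dist(B^j(x), b)` -/

section Leg

variable (C : ChargeData N) (Ω : Finset (HiggsLattice.Site P 0)) (msq a : ℝ)

/-- The scale piece of the VECTOR-field propagator between the fine bonds `b′ = ⟨z, z+εe_ν⟩` and `b = ⟨x_b, x_b+εe_μ⟩`, column `i′`: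
`δ_{νμ}·(G^η_{(j)}(Ω, 0)e_{(x_b,i′)})(z)` — r14 g17's region piece `pieceR` of (2.6) AT ZERO BACKGROUND ([B1] p. 608: *"The renormalization
transformations for vector fields will be obtained by taking N = d and an external vector field A = 0"*; B3 p. 424: *"and the similar
equality for the vector field propagator"*; the selector `δ_{νμ}` as in p03 g4's `B3Ineq212ZeroTorus.vecPieceT`).
[cite: Balaban1983Higgs3, (2.6) p.424, (2.12) p.426] -/
def vecPieceR (k j : ℕ) (b' b : HiggsLattice.Site P 0 × Fin P.d) (i' : Ix N) : EuclideanSpace ℝ (Fin N) :=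
  if b'.2 = b.2 then pieceR C Ω (0 : HiggsLattice.VecField P 0) msq a k j (cb P N 0 (b.1, i')) b'.1 else 0

/-- `G^η_{(j)}(Γ^{(j+1)}_{x_{j+1},x}, b)`, column `i′`: the vector leg `A′^{(j),η}(Γ^{(j+1)}_{x_{j+1},x}) = Σ_{b′⊂Γ} ηA′_{b′}` of (1.3) contracted
with the leg `A′_b` — `Σ_{b′ ⊂ Γ^{(j+1)}_{x_{j+1},x}} ε·δ_{ν(b′)μ(b)}·(G^η_{(j)}(Ω, 0)e_{(x_b,i′)})(z(b′))` (all bonds of `Γ` positively oriented).  B3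
p. 426: *"If a leg A′ of the line is in one of the vertices (1.14) and (1.15), then we have the expression A′^{(j),η}(Γ^{j+1}_{x_{j+1},x}) on the
basis of (1.3)"*. [cite: Balaban1983Higgs3, (2.12) p.426] -/
def gsumR (k j : ℕ) (x : HiggsLattice.Site P 0) (b : HiggsLattice.Site P 0 × Fin P.d) (i' : Ix N) : EuclideanSpace ℝ (Fin N) :=
  ∑ b' ∈ contourBondsR P (j + 1) x, P.mesh 0 • vecPieceR C Ω msq a k j b' b i'

variable {C Ω msq a}

/-- `‖δ_{νμ}G_{(j)}(z, x_b)e_{i′}‖ ≤ ‖G_{(j)}(z, x_b)e_{i′}‖`. [cite: Balaban1983Higgs3, (2.12) p.426] -/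
theorem norm_vecPieceR_le (k j : ℕ) (b' b : HiggsLattice.Site P 0 × Fin P.d) (i' : Ix N) :
    ‖vecPieceR C Ω msq a k j b' b i'‖ ≤ ‖pieceR C Ω (0 : HiggsLattice.VecField P 0) msq a k j (cb P N 0 (b.1, i')) b'.1‖ := by
  unfold vecPieceR
  split_ifs
  · exact le_rfl
  · rw [norm_zero]; exact norm_nonneg _

/-- no pieces beyond `j = k − 1`: the averaged leg vanishes for `j ≥ k`. [cite: Balaban1983Higgs3, (2.6) p.424] -/
theorem gsumR_of_le {k j : ℕ} (hj1 : 1 ≤ j) (hkj : k ≤ j) (x : HiggsLattice.Site P 0) (b : HiggsLattice.Site P 0 × Fin P.d)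
    (i' : Ix N) : gsumR C Ω msq a k j x b i' = 0 := by
  unfold gsumR
  refine Finset.sum_eq_zero fun b' _ => ?_
  unfold vecPieceR
  rw [pieceR_of_le hj1 hkj]
  simp

variable (P) in
/-- `dist(B^j(x), b)` (in `η`-units): `ε` times the torus distance (I.1.3) between the point set `B^j(x)` (the `j`-fold block of `x`,
`HiggsAveraging.blockK`) and the two end-points `x_b`, `x_b + e_μ` of the bond `b`. [cite: Balaban1983Higgs3, (2.12) p.426] -/
def distBlockR (j : ℕ) (x : HiggsLattice.Site P 0) (b : HiggsLattice.Site P 0 × Fin P.d) : ℝ :=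
  P.mesh 0 * (blockK j (blockIter j x)).inf' ⟨x, (mem_blockK j _ x).2 rfl⟩
    fun z => min (HiggsLattice.Site.tdist z b.1 : ℝ) (HiggsLattice.Site.tdist z (b.1.shift b.2) : ℝ)

/-- `dist(B^j(x), b) ≤ ε|x − x_b|` (`x ∈ B^j(x)`). [cite: Balaban1983Higgs3, (2.12) p.426] -/
theorem distBlockR_le (j : ℕ) (x : HiggsLattice.Site P 0) (b : HiggsLattice.Site P 0 × Fin P.d) :
    distBlockR P j x b ≤ P.mesh 0 * (HiggsLattice.Site.tdist x b.1 : ℝ) := by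
  unfold distBlockR
  exact mul_le_mul_of_nonneg_left
    ((Finset.inf'_le _ ((mem_blockK j _ x).2 rfl)).trans (min_le_left _ _)) (P.mesh_pos 0).le

/-- `0 ≤ dist(B^j(x), b)`. [cite: Balaban1983Higgs3, (2.12) p.426] -/
theorem distBlockR_nonneg (j : ℕ) (x : HiggsLattice.Site P 0) (b : HiggsLattice.Site P 0 × Fin P.d) : 0 ≤ distBlockR P j x b := by
  unfold distBlockR
  exact mul_nonneg (P.mesh_pos 0).le (Finset.le_inf' _ _ fun z _ => le_min (Nat.cast_nonneg _) (Nat.cast_nonneg _))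

/-- kernel: `(L^jη)^{−1}·(η·t) = t/L^j`. [folklore] -/
private theorem scale_inv_mul (j : ℕ) (t : ℝ) : (P.mesh j)⁻¹ * (P.mesh 0 * t) = t / (P.L : ℝ) ^ j := by
  rw [mesh_eq_pow_mul P j, mul_inv, mul_assoc, ← mul_assoc (P.mesh 0)⁻¹, inv_mul_cancel₀ (P.mesh_pos 0).ne', one_mul,
    div_eq_inv_mul]

/-- kernel: `(L^jη)·(L^jη)^{2−d} = (L^jη)^{3−d}` (real exponents). [folklore] -/
private theorem mesh_mul_rpow (j : ℕ) :
    P.mesh j * P.mesh j ^ ((2 : ℝ) - (P.d : ℝ)) = P.mesh j ^ ((3 : ℝ) - (P.d : ℝ)) := by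
  rw [show (3 : ℝ) - (P.d : ℝ) = 1 + ((2 : ℝ) - (P.d : ℝ)) by ring, Real.rpow_add (P.mesh_pos j), Real.rpow_one]

/-- **The (2.12) engine** («an additional factor L^jη»): if the value clause of (2.10) holds at zero background between every base point
`z(b′)` of `Γ^{(j+1)}_{x_{j+1},x}` and `x_b` (constants `δ₁ ≥ 0`, `Cst ≥ 0`, `j < k ≤ K`), then
`ε^{−d}Σ_{i′}‖G^η_{(j)}(Γ^{(j+1)}_{x_{j+1},x}, b)e_{i′}‖ ≤ dL·Cst·e^{δ₁L}·(L^jε)^{3−d}e^{−δ₁(L^jε)^{−1}dist(B^j(x),b)}`: at most `d·L^{j+1}` bonds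
(`card_contourBondsR_le`), each of weight `ε` (so `ε·d·L^{j+1} = dL·(L^jε)`), the base points within `L^{j+1} − 1` of `x`
(`tdist_of_mem_contourBondsR_le`, paid by `e^{δ₁L}`), `dist(B^j(x), b) ≤ ε|x − x_b|` (`distBlockR_le`).
[cite: Balaban1983Higgs3, (2.12) p.426] [cite: Balaban1982Higgs1, (2.2) p.608] -/
theorem absGavg_le_of_pointwise {k j : ℕ} (hjk : j < k) (hk : k ≤ P.K) {δ₁ Cst : ℝ} (hδ₁ : 0 ≤ δ₁) (hCst : 0 ≤ Cst)
    {x xb : HiggsLattice.Site P 0} {μ : Fin P.d}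
    (hv : ∀ b' ∈ contourBondsR P (j + 1) x,
      (P.mesh 0 ^ P.d)⁻¹ * ∑ i' : Ix N, ‖pieceR C Ω (0 : HiggsLattice.VecField P 0) msq a k j (cb P N 0 (xb, i')) b'.1‖
        ≤ Cst * P.mesh j ^ ((2 : ℝ) - (P.d : ℝ)) *
          Real.exp (-(δ₁ * (P.mesh j)⁻¹ * (P.mesh 0 * (HiggsLattice.Site.tdist b'.1 xb : ℝ))))) :
    (P.mesh 0 ^ P.d)⁻¹ * ∑ i' : Ix N, ‖gsumR C Ω msq a k j x (xb, μ) i'‖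
      ≤ ((P.d : ℝ) * (P.L : ℝ) * Cst * Real.exp (δ₁ * P.L)) * P.mesh j ^ ((3 : ℝ) - (P.d : ℝ)) *
        Real.exp (-(δ₁ * (P.mesh j)⁻¹ * distBlockR P j x (xb, μ))) := by
  have hjK : j + 1 ≤ P.K := by omega
  have hε : 0 < P.mesh 0 := P.mesh_pos 0
  have hεd : 0 < (P.mesh 0 ^ P.d)⁻¹ := by positivity
  have hmj : 0 < P.mesh j := P.mesh_pos j
  have hL0 : (0 : ℝ) < (P.L : ℝ) := by exact_mod_cast P.hL
  have hLj : (0 : ℝ) < (P.L : ℝ) ^ j := pow_pos hL0 j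
  have hsr : 0 < P.mesh j ^ ((2 : ℝ) - (P.d : ℝ)) := Real.rpow_pos_of_pos hmj _
  set E := Real.exp (-(δ₁ * ((HiggsLattice.Site.tdist x xb : ℝ) / (P.L : ℝ) ^ j))) with hE
  have hE0 : 0 < E := Real.exp_pos _
  -- the value clause at each bond, in the model's units
  have hval : ∀ b' ∈ contourBondsR P (j + 1) x,
      (P.mesh 0 ^ P.d)⁻¹ * ∑ i' : Ix N, ‖pieceR C Ω (0 : HiggsLattice.VecField P 0) msq a k j (cb P N 0 (xb, i')) b'.1‖
        ≤ Cst * P.mesh j ^ ((2 : ℝ) - (P.d : ℝ)) *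
          Real.exp (-(δ₁ * ((HiggsLattice.Site.tdist b'.1 xb : ℝ) / (P.L : ℝ) ^ j))) := by
    intro b' hb'
    have h := hv b' hb'
    rwa [mul_assoc δ₁ ((P.mesh j)⁻¹), scale_inv_mul j] at h
  -- the base points are within `L^{j+1} − 1` of `x`: `e^{−δ₁|z−x_b|/L^j} ≤ e^{δ₁L}e^{−δ₁|x−x_b|/L^j}`
  have hcmp : ∀ b' ∈ contourBondsR P (j + 1) x,
      Real.exp (-(δ₁ * ((HiggsLattice.Site.tdist b'.1 xb : ℝ) / (P.L : ℝ) ^ j))) ≤ Real.exp (δ₁ * P.L) * E := by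
    intro b' hb'
    have hz := tdist_of_mem_contourBondsR_le hjK hb'
    have htri := tdist_triangle_real x b'.1 xb
    have hsym : (HiggsLattice.Site.tdist x b'.1 : ℝ) = (HiggsLattice.Site.tdist b'.1 x : ℝ) := by rw [tdist_comm]
    rw [hE, ← Real.exp_add]
    refine Real.exp_le_exp.2 ?_
    have key : (HiggsLattice.Site.tdist x xb : ℝ) / (P.L : ℝ) ^ j - (HiggsLattice.Site.tdist b'.1 xb : ℝ) / (P.L : ℝ) ^ j
        ≤ P.L := by
      rw [← sub_div, div_le_iff₀ hLj]
      calc (HiggsLattice.Site.tdist x xb : ℝ) - (HiggsLattice.Site.tdist b'.1 xb : ℝ) ≤ (P.L : ℝ) ^ (j + 1) - 1 := by linarith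
        _ ≤ (P.L : ℝ) * (P.L : ℝ) ^ j := by rw [pow_succ]; linarith
    nlinarith [mul_le_mul_of_nonneg_left key hδ₁]
  have hcard : ((contourBondsR P (j + 1) x).card : ℝ) ≤ (P.d : ℝ) * (P.L : ℝ) ^ (j + 1) := by
    refine (card_contourBondsR_le hjK x).trans ?_
    have hd0 : (0 : ℝ) ≤ (P.d : ℝ) := Nat.cast_nonneg _
    nlinarith
  have hdist : E ≤ Real.exp (-(δ₁ * (P.mesh j)⁻¹ * distBlockR P j x (xb, μ))) := by
    rw [hE]
    refine Real.exp_le_exp.2 (neg_le_neg ?_)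
    rw [mul_assoc]
    refine mul_le_mul_of_nonneg_left ?_ hδ₁
    rw [← scale_inv_mul j]
    exact mul_le_mul_of_nonneg_left (distBlockR_le j x (xb, μ)) (inv_pos.2 hmj).le
  -- summing over the bonds of the contour
  calc (P.mesh 0 ^ P.d)⁻¹ * ∑ i' : Ix N, ‖gsumR C Ω msq a k j x (xb, μ) i'‖
      ≤ (P.mesh 0 ^ P.d)⁻¹ * ∑ i' : Ix N, ∑ b' ∈ contourBondsR P (j + 1) x,
          P.mesh 0 * ‖vecPieceR C Ω msq a k j b' (xb, μ) i'‖ := by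
        refine mul_le_mul_of_nonneg_left (Finset.sum_le_sum fun i' _ => ?_) hεd.le
        unfold gsumR
        refine (norm_sum_le _ _).trans (Finset.sum_le_sum fun b' _ => ?_)
        rw [norm_smul, Real.norm_of_nonneg hε.le]
    _ = ∑ b' ∈ contourBondsR P (j + 1) x,
          P.mesh 0 * ((P.mesh 0 ^ P.d)⁻¹ * ∑ i' : Ix N, ‖vecPieceR C Ω msq a k j b' (xb, μ) i'‖) := by
        rw [Finset.sum_comm, Finset.mul_sum]
        refine Finset.sum_congr rfl fun b' _ => ?_
        rw [← Finset.mul_sum]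
        ring
    _ ≤ ∑ b' ∈ contourBondsR P (j + 1) x,
          P.mesh 0 * (Cst * P.mesh j ^ ((2 : ℝ) - (P.d : ℝ)) * (Real.exp (δ₁ * P.L) * E)) := by
        refine Finset.sum_le_sum fun b' hb' => mul_le_mul_of_nonneg_left ?_ hε.le
        calc (P.mesh 0 ^ P.d)⁻¹ * ∑ i' : Ix N, ‖vecPieceR C Ω msq a k j b' (xb, μ) i'‖
            ≤ (P.mesh 0 ^ P.d)⁻¹ * ∑ i' : Ix N,
                ‖pieceR C Ω (0 : HiggsLattice.VecField P 0) msq a k j (cb P N 0 (xb, i')) b'.1‖ :=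
              mul_le_mul_of_nonneg_left (Finset.sum_le_sum fun i' _ => norm_vecPieceR_le k j b' (xb, μ) i') hεd.le
          _ ≤ Cst * P.mesh j ^ ((2 : ℝ) - (P.d : ℝ)) *
                Real.exp (-(δ₁ * ((HiggsLattice.Site.tdist b'.1 xb : ℝ) / (P.L : ℝ) ^ j))) := hval b' hb'
          _ ≤ _ := mul_le_mul_of_nonneg_left (hcmp b' hb') (by positivity)
    _ = (contourBondsR P (j + 1) x).card * (P.mesh 0 * (Cst * P.mesh j ^ ((2 : ℝ) - (P.d : ℝ)) * (Real.exp (δ₁ * P.L) * E))) := by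
        rw [Finset.sum_const, nsmul_eq_mul]
    _ ≤ (P.d : ℝ) * (P.L : ℝ) ^ (j + 1) * (P.mesh 0 * (Cst * P.mesh j ^ ((2 : ℝ) - (P.d : ℝ)) * (Real.exp (δ₁ * P.L) * E))) :=
        mul_le_mul_of_nonneg_right hcard (by positivity)
    _ = (P.d : ℝ) * (P.L : ℝ) * Cst * Real.exp (δ₁ * P.L) * (P.mesh j * P.mesh j ^ ((2 : ℝ) - (P.d : ℝ))) * E := by
        rw [mesh_eq_pow_mul P j]; ring
    _ = (P.d : ℝ) * (P.L : ℝ) * Cst * Real.exp (δ₁ * P.L) * P.mesh j ^ ((3 : ℝ) - (P.d : ℝ)) * E := by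
        rw [mesh_mul_rpow]
    _ ≤ _ := mul_le_mul_of_nonneg_left hdist (by positivity)

end Leg

/-! ## §3 Block-interior points, the carrier on them with the (2.12) fields, and the transfer lemmas -/

section CarrierV

variable {k K₀ : ℕ} {Ω : Finset (HiggsLattice.Site P 0)}

/-- **Block-interior points of `Ω` at scale `k` with cubes of `K₀` blocks**: the sites EVERY point of whose `k`-fold block `B^k(x)` is an
interior point in the sense of r14 g17's `B3Ineq210RegularRegion.Interior` (the lattice ball of radius `2r_S + 2L^kK₀(d+1) + 1` around the
point lies in `Ω`) — the `R₀`-restriction «dist({x,x′}, Ωᶜ) ≥ R₀» of Proposition I.2.1 for the base points of the contours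
`Γ^{(j+1)}_{x_{j+1},x} ⊂ B^{j+1}(x) ⊆ B^k(x)` (`j < k`) of (2.12). [cite: Balaban1982Higgs1, Prop. 2.1 p.610, (2.2) p.608]
[cite: Balaban1983Higgs3, (2.12) p.426] -/
def BlockInterior (k K₀ : ℕ) (Ω : Finset (HiggsLattice.Site P 0)) (x : HiggsLattice.Site P 0) : Prop :=
  ∀ y : HiggsLattice.Site P 0, blockIter k y = blockIter k x → Interior k K₀ Ω y

/-- A block-interior point is interior. [cite: Balaban1982Higgs1, Prop. 2.1 p.610] -/
theorem BlockInterior.interior {x : HiggsLattice.Site P 0} (hx : BlockInterior k K₀ Ω x) : Interior k K₀ Ω x := hx x rfl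

/-- The base points of the contour `Γ^{(n)}_{x_n,x}` (`n ≤ k ≤ K`) of a block-interior point are interior.
[cite: Balaban1982Higgs1, Prop. 2.1 p.610, (2.2) p.608] -/
theorem BlockInterior.interior_of_mem_contourBondsR {n : ℕ} (hnk : n ≤ k) (hk : k ≤ P.K) {x : HiggsLattice.Site P 0}
    (hx : BlockInterior k K₀ Ω x) {b : HiggsLattice.Site P 0 × Fin P.d} (hb : b ∈ contourBondsR P n x) : Interior k K₀ Ω b.1 :=
  hx b.1 (blockIter_of_mem_contourBondsR hnk hk hb)

/-- **A sufficient condition**: if the lattice ball of radius `(2r_S + 2L^kK₀(d+1) + 1) + (L^k − 1)` around `x` lies in `Ω` (`k ≤ K`), then `x`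
is block-interior (the `k`-block has diameter `≤ L^k − 1`, triangle inequality for (I.1.3)). [cite: Balaban1982Higgs1, (1.3) p.604, (1.20) p.607] -/
theorem blockInterior_of_ball (hk : k ≤ P.K) {x : HiggsLattice.Site P 0}
    (h : ∀ y, HiggsLattice.Site.tdist x y ≤ 2 * rS P k K₀ + 2 * half P k K₀ * (P.d + 1) + 1 + (P.L ^ k - 1) → y ∈ Ω) :
    BlockInterior k K₀ Ω x := by
  intro y hy w hw
  apply h
  have h1 : (HiggsLattice.Site.tdist x y : ℝ) ≤ (P.L : ℝ) ^ k - 1 := tdist_le_of_blockIter_eq_real hk hy.symm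
  have h2 := tdist_triangle_real x y w
  have hLk : 1 ≤ P.L ^ k := Nat.one_le_pow _ _ P.hL
  have h3 : (HiggsLattice.Site.tdist x w : ℝ) ≤ ((2 * rS P k K₀ + 2 * half P k K₀ * (P.d + 1) + 1 + (P.L ^ k - 1) : ℕ) : ℝ) := by
    have hw' : (HiggsLattice.Site.tdist y w : ℝ) ≤ ((2 * rS P k K₀ + 2 * half P k K₀ * (P.d + 1) + 1 : ℕ) : ℝ) := by
      exact_mod_cast hw
    push_cast [Nat.cast_sub hLk] at hw' ⊢
    linarith
  exact_mod_cast h3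

/-- Every point of the full torus is block-interior. [cite: Balaban1982Higgs1, Prop. 2.1 p.610] -/
theorem blockInterior_univ (k K₀ : ℕ) (x : HiggsLattice.Site P 0) :
    BlockInterior k K₀ (Finset.univ : Finset (HiggsLattice.Site P 0)) x :=
  fun _ _ w _ => Finset.mem_univ w

end CarrierV

/-- **The concrete carrier of B3 (2.10)/(2.12) on a REGION `Ω ⊊ T_η` at a regular non-constant background `B̃ = A` for the scalar lines**:
sites = the BLOCK-INTERIOR points of `Ω` (`BlockInterior k K₀ Ω`), bonds = positively oriented fine bonds `(base point, direction)` with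
block-interior base point; `dist = ε|x − x′|`; the scalar-line fields `absG j x x′ = ε^{−d}Σ_{i′}‖(G^η_{(j)}(Ω,A)e_{(x′,i′)})(x)‖` and `absDG` exactly as
r14 g17's `regRegionKernels` (the region pieces `pieceR` of (2.6) at the background `A`, restricted to block-interior points; the operators
are not modified); the vector-line field `absGavg j x b = ε^{−d}Σ_{i′}‖G^η_{(j)}(Γ^{(j+1)}_{x_{j+1},x}, b)e_{i′}‖` (`gsumR`: the pieces AT ZERO BACKGROUND
summed along the composite contour with the selector `δ_{νμ}`, [B1] p. 608 «N = d and an external vector field A = 0») and `distBlock j x b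
= dist(B^j(x), b)` (`distBlockR`); the (2.5)/(2.11) fields are not modelled (`0`).
[cite: Balaban1983Higgs3, (2.6) p.424, (2.10), (2.12) p.426] [cite: Balaban1982Higgs1, Prop. 2.1 p.610] -/
def regRegionKernelsV {P : HiggsLattice.Params} {N : ℕ} (hL1 : 1 < P.L) (C : ChargeData N) (Ω : Finset (HiggsLattice.Site P 0))
    (A : HiggsLattice.VecField P 0) (msq a : ℝ) (k K₀ : ℕ) : ScaledKernels where
  Site := {x : HiggsLattice.Site P 0 // BlockInterior k K₀ Ω x}
  Bond := {x : HiggsLattice.Site P 0 // BlockInterior k K₀ Ω x} × Fin P.d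
  Dir := Fin P.d
  LocFn := PUnit
  dist := fun x x' => P.mesh 0 * (HiggsLattice.Site.tdist x.1 x'.1 : ℝ)
  dist2 := fun _ _ _ => 0
  distBlock := fun j x b => distBlockR P j x.1 (b.1.1, b.2)
  distSupp := fun _ _ => 0
  distΩ₂ := 0
  L := P.L
  η := P.mesh 0
  d := P.d
  eRun := 0
  pRun := 0
  one_lt_L := by exact_mod_cast hL1
  η_pos := P.mesh_pos 0
  absG := fun j x x' => (P.mesh 0 ^ P.d)⁻¹ * ∑ i' : Ix N, ‖pieceR C Ω A msq a k j (cb P N 0 (x'.1, i')) x.1‖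
  absDG := fun j μ x x' => (P.mesh 0 ^ P.d)⁻¹ * ∑ i' : Ix N, ‖covDeriv C A (pieceR C Ω A msq a k j (cb P N 0 (x'.1, i'))) ⟨x.1, μ⟩‖
  holderDiff := fun _ _ _ _ _ => 0
  absGavg := fun j x b => (P.mesh 0 ^ P.d)⁻¹ * ∑ i' : Ix N, ‖gsumR C Ω msq a k j x.1 (b.1.1, b.2) i'‖
  normDeltaG := fun _ _ _ => 0
  norm116 := fun _ _ _ _ _ => 0

section CarrierV2

variable {hL1 : 1 < P.L} {C : ChargeData N} {Ω : Finset (HiggsLattice.Site P 0)} {A : HiggsLattice.VecField P 0} {msq a : ℝ}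
  {k K₀ : ℕ}

/-- the carrier's `L^jη` is the model's `L^jε`. [cite: Balaban1983Higgs3, (2.12) p.426] -/
theorem scaleV_eq (j : ℕ) : (regRegionKernelsV hL1 C Ω A msq a k K₀).scale j = P.mesh j := by
  show (P.L : ℝ) ^ j * P.mesh 0 = P.mesh j
  rw [mesh_eq_pow_mul P j]

/-- kernel: `(L^jη)^{2−d} = (L^jη)²·((L^jη)^d)^{−1}`. [folklore] -/
private theorem rpow_two_sub (j : ℕ) : P.mesh j ^ ((2 : ℝ) - (P.d : ℝ)) = P.mesh j ^ 2 * (P.mesh j ^ P.d)⁻¹ := by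
  rw [Real.rpow_sub (P.mesh_pos j), div_eq_mul_inv, Real.rpow_natCast _ P.d, Real.rpow_two]

/-- kernel: `(L^jη)^{1−d} = (L^jη)·((L^jη)^d)^{−1}`. [folklore] -/
private theorem rpow_one_sub (j : ℕ) : P.mesh j ^ ((1 : ℝ) - (P.d : ℝ)) = P.mesh j * (P.mesh j ^ P.d)⁻¹ := by
  rw [Real.rpow_sub (P.mesh_pos j), div_eq_mul_inv, Real.rpow_natCast _ P.d, Real.rpow_one]

/-- kernel: `(L^jη)^{−1}·(ε|x − x′|) = |x − x′|/L^j`. [folklore] -/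
private theorem scale_inv_mul_dist (j : ℕ) (x x' : HiggsLattice.Site P 0) :
    (P.mesh j)⁻¹ * (P.mesh 0 * (HiggsLattice.Site.tdist x x' : ℝ)) = (HiggsLattice.Site.tdist x x' : ℝ) / (P.L : ℝ) ^ j := by
  rw [mesh_eq_pow_mul P j, mul_inv, mul_assoc, ← mul_assoc (P.mesh 0)⁻¹, inv_mul_cancel₀ (P.mesh_pos 0).ne', one_mul,
    div_eq_inv_mul]

/-- **Transfer for (2.10)**: r14 g17's kernel bounds at interior points (the shape of `ineq210_of_boundsR`'s hypotheses) give `Ineq210` for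
the block-interior carrier (block-interior points are interior). [cite: Balaban1983Higgs3, (2.10) p.426] -/
theorem ineq210_of_boundsV {δ₁ Cst : ℝ}
    (hv : ∀ (j : ℕ) (x x' : HiggsLattice.Site P 0), Interior k K₀ Ω x → Interior k K₀ Ω x' →
      (P.mesh 0 ^ P.d)⁻¹ * ∑ i' : Ix N, ‖pieceR C Ω A msq a k j (cb P N 0 (x', i')) x‖
        ≤ Cst * (P.mesh j ^ 2 * (P.mesh j ^ P.d)⁻¹) *
          Real.exp (-(δ₁ * ((HiggsLattice.Site.tdist x x' : ℝ) / (P.L : ℝ) ^ j))))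
    (hd : ∀ (j : ℕ) (μ : Fin P.d) (x x' : HiggsLattice.Site P 0), Interior k K₀ Ω x → Interior k K₀ Ω x' →
      (P.mesh 0 ^ P.d)⁻¹ * ∑ i' : Ix N, ‖covDeriv C A (pieceR C Ω A msq a k j (cb P N 0 (x', i'))) ⟨x, μ⟩‖
        ≤ Cst * (P.mesh j * (P.mesh j ^ P.d)⁻¹) *
          Real.exp (-(δ₁ * ((HiggsLattice.Site.tdist x x' : ℝ) / (P.L : ℝ) ^ j)))) :
    (regRegionKernelsV hL1 C Ω A msq a k K₀).Ineq210 δ₁ Cst := by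
  intro j x x'
  have e1 : (regRegionKernelsV hL1 C Ω A msq a k K₀).absG j x x'
      = (P.mesh 0 ^ P.d)⁻¹ * ∑ i' : Ix N, ‖pieceR C Ω A msq a k j (cb P N 0 (x'.1, i')) x.1‖ := rfl
  have e2 : ∀ μ : Fin P.d, (regRegionKernelsV hL1 C Ω A msq a k K₀).absDG j μ x x'
      = (P.mesh 0 ^ P.d)⁻¹ * ∑ i' : Ix N, ‖covDeriv C A (pieceR C Ω A msq a k j (cb P N 0 (x'.1, i'))) ⟨x.1, μ⟩‖ := fun _ => rfl
  have e3 : (regRegionKernelsV hL1 C Ω A msq a k K₀).dist x x' = P.mesh 0 * (HiggsLattice.Site.tdist x.1 x'.1 : ℝ) := rfl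
  have e4 : (regRegionKernelsV hL1 C Ω A msq a k K₀).d = P.d := rfl
  rw [scaleV_eq, e1, e3, e4, rpow_two_sub, rpow_one_sub, mul_assoc δ₁, scale_inv_mul_dist]
  refine ⟨hv j x.1 x'.1 x.2.interior x'.2.interior, fun μ => ?_⟩
  rw [e2]
  exact hd j μ x.1 x'.1 x.2.interior x'.2.interior

/-- **Transfer for (2.12)**: a bound on the averaged leg at block-interior `x`, `x_b`, in the model's units, gives `Ineq212` for the carrier.
[cite: Balaban1983Higgs3, (2.12) p.426] -/
theorem ineq212_of_boundV {δ₁ Cst : ℝ}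
    (h : ∀ (j : ℕ) (x xb : HiggsLattice.Site P 0) (μ : Fin P.d), BlockInterior k K₀ Ω x → BlockInterior k K₀ Ω xb →
      (P.mesh 0 ^ P.d)⁻¹ * ∑ i' : Ix N, ‖gsumR C Ω msq a k j x (xb, μ) i'‖
        ≤ Cst * P.mesh j ^ ((3 : ℝ) - (P.d : ℝ)) * Real.exp (-(δ₁ * (P.mesh j)⁻¹ * distBlockR P j x (xb, μ)))) :
    (regRegionKernelsV hL1 C Ω A msq a k K₀).Ineq212 δ₁ Cst := by
  intro j x b
  have e1 : (regRegionKernelsV hL1 C Ω A msq a k K₀).absGavg j x b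
      = (P.mesh 0 ^ P.d)⁻¹ * ∑ i' : Ix N, ‖gsumR C Ω msq a k j x.1 (b.1.1, b.2) i'‖ := rfl
  have e2 : (regRegionKernelsV hL1 C Ω A msq a k K₀).distBlock j x b = distBlockR P j x.1 (b.1.1, b.2) := rfl
  have e3 : (regRegionKernelsV hL1 C Ω A msq a k K₀).d = P.d := rfl
  rw [scaleV_eq, e1, e2, e3]
  exact h j x.1 b.1.1 b.2 x.2 b.1.2

end CarrierV2

/-! ## §4 (2.12) PROVED for the region carrier: `Ω ⊊ T_η` a big-block union, block-interior points, scalar lines at a regular background -/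

section MainV

/-- weakening of the constant in a bound of the shape `C·s·e`. [folklore] -/
private theorem bound_mono {C C' s e v : ℝ} (h : v ≤ C * s * e) (hC : C ≤ C') (hs : 0 ≤ s) (he : 0 ≤ e) : v ≤ C' * s * e :=
  h.trans (mul_le_mul_of_nonneg_right (mul_le_mul_of_nonneg_right hC hs) he)

/-- `Cst ≤ dL·Cst·e^{δ₁L}` for `d ≥ 1`, `L ≥ 1`, `δ₁ ≥ 0`, `Cst ≥ 0`. [folklore] -/
private theorem le_cst212 {d L : ℕ} (hd : 1 ≤ d) (hL : 1 ≤ L) {Cst δ₁ : ℝ} (hCst : 0 ≤ Cst) (hδ₁ : 0 ≤ δ₁) :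
    Cst ≤ (d : ℝ) * (L : ℝ) * Cst * Real.exp (δ₁ * L) := by
  have hd' : (1 : ℝ) ≤ d := by exact_mod_cast hd
  have hL' : (1 : ℝ) ≤ L := by exact_mod_cast hL
  have he : 1 ≤ Real.exp (δ₁ * L) := Real.one_le_exp (by positivity)
  have hdL : (1 : ℝ) ≤ (d : ℝ) * (L : ℝ) := by nlinarith
  calc Cst = 1 * Cst * 1 := by ring
    _ ≤ (d : ℝ) * (L : ℝ) * Cst * Real.exp (δ₁ * L) := by
        refine mul_le_mul (mul_le_mul_of_nonneg_right hdL hCst) he zero_le_one (by positivity)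

/-- **B3 (2.10) AND (2.12) p. 426 [PDF 16] PROVED TOGETHER ON A REGION `Ω ⊊ T_η` — scalar lines at a regular non-constant background
`B̃ = A`, vector lines at zero background — at block-interior points, uniformly in the volume, with the same constants.**  For `d ≥ 1`,
`L ≥ 2`, `a, m² > 0`, a regularity constant `c ≥ 0` and `N` there is `E₀ > 0` such that for every charge with `e² ≤ E₀` there is a threshold
`K₀,min` and, for every `K₀ ≥ K₀,min`, constants `t, δ₁, C > 0` with: for every volume `P` with these `d, L` and `K₀ ∣ M`, every scale
`1 ≤ k ≤ K` with `L^kε ≤ 1` and `3L^kK₀ ≤ |T_ε|_μ`, every region `Ω ⊂ T_ε` that is a union of big blocks (`IsBigBlockUnion k K₀ Ω`), and every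
configuration `A` that is `δ_A`-regular ON `Ω` with `L^kδ_A|e| ≤ t` and `L^kδ_A ≤ c|e|`:
`(regRegionKernelsV _ C Ω A m² a k K₀).Ineq210 δ₁ C ∧ (regRegionKernelsV _ C Ω A m² a k K₀).Ineq212 δ₁ C`.
Route = print's «rescaling … and application of Propositions I.2.1 and I.2.3» through r14 g17's `ineq210_regularRegion_explicit` (once at
the background `A` for the scalar lines, once at `A = 0` for the vector pieces — the hypotheses hold there with `δ_A = 0`) and the engine
`absGavg_le_of_pointwise` («an additional factor L^jη»); the constant is `dL·C_{(2.10)}·e^{δ₁L}`.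
[cite: Balaban1983Higgs3, (2.6) p.424, (2.10), (2.12) p.426] [cite: Balaban1982Higgs1, Prop. 2.1 p.610, Prop. 2.3 p.611, (2.2) p.608] -/
theorem ineq210_and_212_regularRegionV (d L : ℕ) (hd : 1 ≤ d) (hL : 2 ≤ L) {a : ℝ} (ha : 0 < a) {msq : ℝ} (hmsq : 0 < msq)
    {c : ℝ} (hc : 0 ≤ c) (N : ℕ) :
    ∃ E₀ : ℝ, 0 < E₀ ∧ ∀ (C : ChargeData N), C.e ^ 2 ≤ E₀ →
      ∃ K₀min : ℕ, ∀ K₀ : ℕ, K₀min ≤ K₀ → ∃ t δ₁ Cst : ℝ, 0 < t ∧ 0 < δ₁ ∧ 0 < Cst ∧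
      ∀ (P : HiggsLattice.Params) (hP1 : 1 < P.L), P.d = d → P.L = L → K₀ ∣ P.M →
      ∀ {k : ℕ}, 1 ≤ k → k ≤ P.K → (∀ μ, 3 * half P k K₀ ≤ P.sitesPerDir 0 μ) → P.mesh k ≤ 1 →
      ∀ (Ω : Finset (HiggsLattice.Site P 0)), IsBigBlockUnion k K₀ Ω →
      ∀ (A : HiggsLattice.VecField P 0) {δA : ℝ}, 0 ≤ δA →
        (∀ z ∈ Ω, ∀ μ ν : Fin P.d, |A ⟨z.shift ν, μ⟩ - A ⟨z, μ⟩| ≤ δA) →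
        (P.L : ℝ) ^ k * δA * |C.e| ≤ t → (P.L : ℝ) ^ k * δA ≤ c * |C.e| →
        (regRegionKernelsV hP1 C Ω A msq a k K₀).Ineq210 δ₁ Cst ∧ (regRegionKernelsV hP1 C Ω A msq a k K₀).Ineq212 δ₁ Cst := by
  obtain ⟨E₀, hE₀, h⟩ := ineq210_regularRegion_explicit d L hd hL ha hmsq hc N
  refine ⟨E₀, hE₀, fun C heE => ?_⟩
  obtain ⟨K₀min, h⟩ := h C heE
  refine ⟨K₀min, fun K₀ hK₀ => ?_⟩
  obtain ⟨t, δ₁, Cst, ht, hδ₁, hCst, h⟩ := h K₀ hK₀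
  have hL1 : 1 ≤ L := by omega
  refine ⟨t, δ₁, (d : ℝ) * (L : ℝ) * Cst * Real.exp (δ₁ * L), ht, hδ₁, ?_, ?_⟩
  · have hd0 : (0 : ℝ) < d := by exact_mod_cast hd
    have hL0 : (0 : ℝ) < L := by exact_mod_cast (by omega : 0 < L)
    positivity
  intro P hP1 hPd hPL hK₀M k hk1 hkK h3 hmesh Ω hΩ A δA hδA hreg ht' hcA
  have hCC : Cst ≤ (d : ℝ) * (L : ℝ) * Cst * Real.exp (δ₁ * L) := le_cst212 hd hL1 hCst.le hδ₁.le
  -- (2.10) at the background `A` (scalar lines) and at `A = 0` (vector lines), at interior points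
  have hA := h P hP1 hPd hPL hK₀M hk1 hkK h3 hmesh Ω hΩ A hδA hreg ht' hcA
  have h0 := h P hP1 hPd hPL hK₀M hk1 hkK h3 hmesh Ω hΩ (0 : HiggsLattice.VecField P 0) (δA := 0) le_rfl
    (fun z _ μ ν => by simp) (by rw [mul_zero, zero_mul]; exact ht.le) (by rw [mul_zero]; positivity)
  subst hPd hPL
  refine ⟨ineq210_of_boundsV (fun j x x' hx hx' => ?_) (fun j μ x x' hx hx' => ?_), ineq212_of_boundV (fun j x xb μ hx hxb => ?_)⟩
  · have hmj : 0 < P.mesh j := P.mesh_pos j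
    have h1 := (hA j x x' hx hx').1
    rw [rpow_two_sub, mul_assoc δ₁, scale_inv_mul_dist] at h1
    exact bound_mono h1 hCC (by positivity) (Real.exp_pos _).le
  · have hmj : 0 < P.mesh j := P.mesh_pos j
    have h1 := (hA j x x' hx hx').2 μ
    rw [rpow_one_sub, mul_assoc δ₁, scale_inv_mul_dist] at h1
    exact bound_mono h1 hCC (by positivity) (Real.exp_pos _).le
  · have hmj : 0 < P.mesh j := P.mesh_pos j
    rcases Nat.lt_or_ge j k with hjk | hkj
    · -- `j < k ≤ K`: every base point of `Γ^{(j+1)}_{x_{j+1},x}` is interior, and so is `x_b`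
      exact absGavg_le_of_pointwise hjk hkK hδ₁.le hCst.le fun b' hb' =>
        (h0 j b'.1 xb (hx.interior_of_mem_contourBondsR (by omega) hkK hb') hxb.interior).1
    · -- `j ≥ k`: no piece, the averaged leg vanishes
      have hzero : ∀ i' : Ix N, gsumR C Ω msq a k j x (xb, μ) i' = 0 :=
        fun i' => gsumR_of_le (hk1.trans hkj) hkj x (xb, μ) i'
      simp_rw [hzero, norm_zero, Finset.sum_const_zero, mul_zero]
      positivity

/-- **B3 (2.12) p. 426 [PDF 16] PROVED ON A REGION `Ω ⊊ T_η` AT BLOCK-INTERIOR POINTS, uniformly in the volume** — the decl of record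
`ScaledKernels.Ineq212 δ₁ C` of row B3.Eq2.12 DISCHARGED for the concrete carrier `regRegionKernelsV _ C Ω A m² a k K₀` under the hypotheses of
r14 g17's region (2.10): i.e. for all `j`, all block-interior `x ∈ Ω` and fine bonds `b` with block-interior base point,
`ε^{−d}Σ_{i′}‖G^η_{(j)}(Γ^{(j+1)}_{x_{j+1},x}, b)e_{i′}‖ ≤ C(L^jη)^{3−d}e^{−δ₁(L^jη)^{−1}dist(B^j(x),b)}`.  Print: *"For each such expression we have an
additional factor L^jη on the right side, e.g. we have (2.12)."*  [cite: Balaban1983Higgs3, (2.12) p.426]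
[cite: Balaban1982Higgs1, Prop. 2.1 p.610, (2.2) p.608] -/
theorem ineq212_regularRegion (d L : ℕ) (hd : 1 ≤ d) (hL : 2 ≤ L) {a : ℝ} (ha : 0 < a) {msq : ℝ} (hmsq : 0 < msq)
    {c : ℝ} (hc : 0 ≤ c) (N : ℕ) :
    ∃ E₀ : ℝ, 0 < E₀ ∧ ∀ (C : ChargeData N), C.e ^ 2 ≤ E₀ →
      ∃ K₀min : ℕ, ∀ K₀ : ℕ, K₀min ≤ K₀ → ∃ t δ₁ Cst : ℝ, 0 < t ∧ 0 < δ₁ ∧ 0 < Cst ∧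
      ∀ (P : HiggsLattice.Params) (hP1 : 1 < P.L), P.d = d → P.L = L → K₀ ∣ P.M →
      ∀ {k : ℕ}, 1 ≤ k → k ≤ P.K → (∀ μ, 3 * half P k K₀ ≤ P.sitesPerDir 0 μ) → P.mesh k ≤ 1 →
      ∀ (Ω : Finset (HiggsLattice.Site P 0)), IsBigBlockUnion k K₀ Ω →
      ∀ (A : HiggsLattice.VecField P 0) {δA : ℝ}, 0 ≤ δA →
        (∀ z ∈ Ω, ∀ μ ν : Fin P.d, |A ⟨z.shift ν, μ⟩ - A ⟨z, μ⟩| ≤ δA) →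
        (P.L : ℝ) ^ k * δA * |C.e| ≤ t → (P.L : ℝ) ^ k * δA ≤ c * |C.e| →
        (regRegionKernelsV hP1 C Ω A msq a k K₀).Ineq212 δ₁ Cst := by
  obtain ⟨E₀, hE₀, h⟩ := ineq210_and_212_regularRegionV d L hd hL ha hmsq hc N
  refine ⟨E₀, hE₀, fun C heE => ?_⟩
  obtain ⟨K₀min, h⟩ := h C heE
  refine ⟨K₀min, fun K₀ hK₀ => ?_⟩
  obtain ⟨t, δ₁, Cst, ht, hδ₁, hCst, h⟩ := h K₀ hK₀
  refine ⟨t, δ₁, Cst, ht, hδ₁, hCst, ?_⟩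
  intro P hP1 hPd hPL hK₀M k hk1 hkK h3 hmesh Ω hΩ A δA hδA hreg ht' hcA
  exact (h P hP1 hPd hPL hK₀M hk1 hkK h3 hmesh Ω hΩ A hδA hreg ht' hcA).2

/-- **The same, un-subtyped**: (2.12) on the region for every `j`, every block-interior `x` and every fine bond `⟨x_b, x_b + εe_μ⟩` with
block-interior base point, in the model's units — the form consumers on the full lattice use.
[cite: Balaban1983Higgs3, (2.12) p.426] [cite: Balaban1982Higgs1, Prop. 2.1 p.610] -/
theorem ineq212_regularRegion_explicit (d L : ℕ) (hd : 1 ≤ d) (hL : 2 ≤ L) {a : ℝ} (ha : 0 < a) {msq : ℝ} (hmsq : 0 < msq)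
    {c : ℝ} (hc : 0 ≤ c) (N : ℕ) :
    ∃ E₀ : ℝ, 0 < E₀ ∧ ∀ (C : ChargeData N), C.e ^ 2 ≤ E₀ →
      ∃ K₀min : ℕ, ∀ K₀ : ℕ, K₀min ≤ K₀ → ∃ t δ₁ Cst : ℝ, 0 < t ∧ 0 < δ₁ ∧ 0 < Cst ∧
      ∀ (P : HiggsLattice.Params), 1 < P.L → P.d = d → P.L = L → K₀ ∣ P.M →
      ∀ {k : ℕ}, 1 ≤ k → k ≤ P.K → (∀ μ, 3 * half P k K₀ ≤ P.sitesPerDir 0 μ) → P.mesh k ≤ 1 →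
      ∀ (Ω : Finset (HiggsLattice.Site P 0)), IsBigBlockUnion k K₀ Ω →
      ∀ (A : HiggsLattice.VecField P 0) {δA : ℝ}, 0 ≤ δA →
        (∀ z ∈ Ω, ∀ μ ν : Fin P.d, |A ⟨z.shift ν, μ⟩ - A ⟨z, μ⟩| ≤ δA) →
        (P.L : ℝ) ^ k * δA * |C.e| ≤ t → (P.L : ℝ) ^ k * δA ≤ c * |C.e| →
        ∀ (j : ℕ) (x xb : HiggsLattice.Site P 0) (μ : Fin P.d), BlockInterior k K₀ Ω x → BlockInterior k K₀ Ω xb →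
          (P.mesh 0 ^ P.d)⁻¹ * ∑ i' : Ix N, ‖gsumR C Ω msq a k j x (xb, μ) i'‖
            ≤ Cst * P.mesh j ^ ((3 : ℝ) - (P.d : ℝ)) * Real.exp (-(δ₁ * (P.mesh j)⁻¹ * distBlockR P j x (xb, μ))) := by
  obtain ⟨E₀, hE₀, h⟩ := ineq212_regularRegion d L hd hL ha hmsq hc N
  refine ⟨E₀, hE₀, fun C heE => ?_⟩
  obtain ⟨K₀min, h⟩ := h C heE
  refine ⟨K₀min, fun K₀ hK₀ => ?_⟩
  obtain ⟨t, δ₁, Cst, ht, hδ₁, hCst, h⟩ := h K₀ hK₀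
  refine ⟨t, δ₁, Cst, ht, hδ₁, hCst, ?_⟩
  intro P hP1 hPd hPL hK₀M k hk1 hkK h3 hmesh Ω hΩ A δA hδA hreg ht' hcA j x xb μ hx hxb
  have h' := h P hP1 hPd hPL hK₀M hk1 hkK h3 hmesh Ω hΩ A hδA hreg ht' hcA j ⟨x, hx⟩ (⟨xb, hxb⟩, μ)
  rw [scaleV_eq] at h'
  exact h'

/-- **(2.12) on the FULL torus `Ω = T_ε`, EVERY `L ≥ 2`** (no parity hypothesis; scalar lines at a regular non-constant background): the
case `Ω = univ` of `ineq212_regularRegion` (`IsBigBlockUnion` holds for the whole torus, every point is block-interior — `blockInterior_univ`).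
Complements the odd-`L`, zero-background torus member `B3Ineq212ZeroTorus.ineq212_zeroTorusV` of p03 g4 (which has no `e² ≤ E₀` / cube-tiling
conditions). [cite: Balaban1983Higgs3, (2.12) p.426] [cite: Balaban1982Higgs1, Prop. 2.1 p.610, Prop. 2.3 p.611] -/
theorem ineq212_regularRegion_univ (d L : ℕ) (hd : 1 ≤ d) (hL : 2 ≤ L) {a : ℝ} (ha : 0 < a) {msq : ℝ} (hmsq : 0 < msq)
    {c : ℝ} (hc : 0 ≤ c) (N : ℕ) :
    ∃ E₀ : ℝ, 0 < E₀ ∧ ∀ (C : ChargeData N), C.e ^ 2 ≤ E₀ →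
      ∃ K₀min : ℕ, ∀ K₀ : ℕ, K₀min ≤ K₀ → ∃ t δ₁ Cst : ℝ, 0 < t ∧ 0 < δ₁ ∧ 0 < Cst ∧
      ∀ (P : HiggsLattice.Params) (hP1 : 1 < P.L), P.d = d → P.L = L → K₀ ∣ P.M →
      ∀ {k : ℕ}, 1 ≤ k → k ≤ P.K → (∀ μ, 3 * half P k K₀ ≤ P.sitesPerDir 0 μ) → P.mesh k ≤ 1 →
      ∀ (A : HiggsLattice.VecField P 0) {δA : ℝ}, 0 ≤ δA →
        (∀ (z : HiggsLattice.Site P 0) (μ ν : Fin P.d), |A ⟨z.shift ν, μ⟩ - A ⟨z, μ⟩| ≤ δA) →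
        (P.L : ℝ) ^ k * δA * |C.e| ≤ t → (P.L : ℝ) ^ k * δA ≤ c * |C.e| →
        (regRegionKernelsV hP1 C Finset.univ A msq a k K₀).Ineq212 δ₁ Cst := by
  obtain ⟨E₀, hE₀, h⟩ := ineq212_regularRegion d L hd hL ha hmsq hc N
  refine ⟨E₀, hE₀, fun C heE => ?_⟩
  obtain ⟨K₀min, h⟩ := h C heE
  refine ⟨K₀min, fun K₀ hK₀ => ?_⟩
  obtain ⟨t, δ₁, Cst, ht, hδ₁, hCst, h⟩ := h K₀ hK₀
  refine ⟨t, δ₁, Cst, ht, hδ₁, hCst, ?_⟩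
  intro P hP1 hPd hPL hK₀M k hk1 hkK h3 hmesh A δA hδA hreg ht' hcA
  exact h P hP1 hPd hPL hK₀M hk1 hkK h3 hmesh Finset.univ isBigBlockUnion_univ A hδA (fun z _ μ ν => hreg z μ ν) ht' hcA

end MainV

/-! ## §5 Non-vacuity: a PROPER region with a block-interior point at an admissible cube size (r14 g17's slab, one block wider margin) -/

section WitnessV

/-- kernel: the torus coordinate distance from a base label `ρ` controls the label (r14 g17's lemma, copied: it is private there). [folklore] -/
private theorem val_le_of_min_le {n₀ ρ : ℕ} [NeZero n₀] (hρ : ρ < n₀) {b : ZMod n₀}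
    (h : min (((ρ : ℕ) : ZMod n₀) - b).val (b - ((ρ : ℕ) : ZMod n₀)).val ≤ ρ) : b.val ≤ 2 * ρ := by
  have ha : (((ρ : ℕ) : ZMod n₀)).val = ρ := ZMod.val_cast_of_lt hρ
  have hb : b.val < n₀ := ZMod.val_lt b
  rcases le_or_gt b.val ρ with hle | hlt
  · omega
  · have hba : (b - ((ρ : ℕ) : ZMod n₀)).val = b.val - ρ := by
      rw [ZMod.val_sub (by rw [ha]; exact hlt.le), ha]
    have hne : b - ((ρ : ℕ) : ZMod n₀) ≠ 0 := by
      intro h0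
      have := congrArg ZMod.val h0
      rw [hba, ZMod.val_zero] at this
      omega
    have hab : (((ρ : ℕ) : ZMod n₀) - b).val = n₀ - (b.val - ρ) := by
      rw [← neg_sub, ZMod.neg_val, if_neg hne, hba]
    rw [hab, hba] at h
    rcases min_le_iff.mp h with h1 | h1
    · omega
    · omega

/-- **Non-vacuity of the hypotheses of `ineq212_regularRegion` with a PROPER region whose block-interior is non-empty.**  For `d ≥ 1`,
`L ≥ 2` and every threshold `K₀,min` there are `K₀ ≥ K₀,min` and a volume `P` with these `d, L`, `K₀ ∣ M`, `1 ≤ K`, at scale `k = 1`: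
`3·half ≤ |T_ε|_μ` in every direction and `Lε ≤ 1`, together with a big-block union `Ω ≠ T_ε` (a slab of cells, r14 g17's
`regularRegion_hypotheses_nonvacuous` with the margin widened by the block diameter `L − 1`) and a point `x` with `BlockInterior 1 K₀ Ω x`
(through `blockInterior_of_ball`); the field hypotheses hold at `A = 0`, `δ_A = 0` (for every `t > 0`, `c ≥ 0`, every charge).  So the
family of `ineq212_regularRegion` contains proper regions with block-interior points at every admissible cube size.
[cite: Balaban1983Higgs3, (2.12) p.426] [cite: Balaban1982Higgs1, (1.2) p.604, Prop. 2.1 p.610] -/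
theorem blockInterior_hypotheses_nonvacuous (d L : ℕ) (hd : 1 ≤ d) (hL : 2 ≤ L) (K₀min : ℕ) :
    ∃ K₀ : ℕ, K₀min ≤ K₀ ∧ ∃ (P : HiggsLattice.Params), 1 < P.L ∧ P.d = d ∧ P.L = L ∧ K₀ ∣ P.M ∧ 1 ≤ P.K ∧
      (∀ μ, 3 * half P 1 K₀ ≤ P.sitesPerDir 0 μ) ∧ P.mesh 1 ≤ 1 ∧
      ∃ Ω : Finset (HiggsLattice.Site P 0), IsBigBlockUnion 1 K₀ Ω ∧ Ω ≠ Finset.univ ∧ (∃ x, BlockInterior 1 K₀ Ω x) ∧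
        ∀ z ∈ Ω, ∀ μ ν : Fin P.d,
          |(0 : HiggsLattice.VecField P 0) ⟨z.shift ν, μ⟩ - (0 : HiggsLattice.VecField P 0) ⟨z, μ⟩| ≤ 0 := by
  have hL0 : 0 < L := by omega
  -- the cube size, the margin `ρ₀` (r14's margin plus the block diameter `L − 1`), the slab width `n` (cells) and the volume
  obtain ⟨K₀, hK₀, hK₀1⟩ : ∃ K₀, K₀min ≤ K₀ ∧ 1 ≤ K₀ := ⟨max K₀min 1, le_max_left _ _, le_max_right _ _⟩
  obtain ⟨ρ₀, hρ₀⟩ : ∃ ρ₀ : ℕ, ρ₀ = 2 * (5 * (L ^ 1 * K₀) / 8 + L ^ 1) + 2 * (L ^ 1 * K₀) * (d + 1) + 1 + (L ^ 1 - 1) :=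
    ⟨_, rfl⟩
  obtain ⟨n, hn⟩ : ∃ n : ℕ, n = 2 * ρ₀ + 1 := ⟨_, rfl⟩
  have hn3 : 3 ≤ n := by omega
  have hLK : 1 ≤ L * K₀ := Nat.one_le_iff_ne_zero.mpr (Nat.mul_ne_zero (by omega) (by omega))
  let P : HiggsLattice.Params :=
    ⟨d, ((L : ℝ))⁻¹, 1, L, K₀ * n, fun _ => 1, hd, by positivity, hL0, Nat.mul_pos (by omega) (by omega), fun _ => one_pos⟩
  have hhalf : half P 1 K₀ = L * K₀ := by show L ^ 1 * K₀ = L * K₀; rw [pow_one]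
  have hsites : ∀ μ : Fin d, P.sitesPerDir 0 μ = 2 * (L * (K₀ * n)) := by
    intro μ; show 2 * (L ^ (1 - 0) * (K₀ * n) * 1) = _; rw [Nat.sub_zero, pow_one, mul_one]
  have hhalf_pos : 0 < half P 1 K₀ := by rw [hhalf]; omega
  refine ⟨K₀, hK₀, P, lt_of_lt_of_le (by norm_num) hL, rfl, rfl, Dvd.intro n rfl, le_rfl, ?_, ?_, ?_⟩
  · intro μ
    rw [hhalf, hsites μ]
    calc 3 * (L * K₀) ≤ n * (L * K₀) := Nat.mul_le_mul_right _ hn3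
      _ = L * (K₀ * n) := by ring
      _ ≤ 2 * (L * (K₀ * n)) := Nat.le_mul_of_pos_left _ (by norm_num)
  · show (L : ℝ) ^ 1 * ((L : ℝ))⁻¹ ≤ 1
    rw [pow_one, mul_inv_cancel₀ (by exact_mod_cast hL0.ne')]
  -- the slab `Ω` of `n` cells in direction `μ₀`
  let μ₀ : Fin d := ⟨0, hd⟩
  refine ⟨Finset.univ.filter (fun x : HiggsLattice.Site P 0 => (x μ₀).val / half P 1 K₀ < n), ?_, ?_, ?_, ?_⟩
  · intro x x' h
    simp only [Finset.mem_filter, Finset.mem_univ, true_and]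
    rw [h μ₀]
  · -- proper: the site with label `n·half` in direction `μ₀` is outside
    intro hΩ
    have hlt : n * half P 1 K₀ < P.sitesPerDir 0 μ₀ := by
      rw [hhalf, hsites μ₀]
      calc n * (L * K₀) = L * (K₀ * n) := by ring
        _ < 2 * (L * (K₀ * n)) := by
          have : 0 < L * (K₀ * n) := Nat.mul_pos hL0 (Nat.mul_pos (by omega) (by omega))
          omega
    let z : HiggsLattice.Site P 0 := fun μ => ((n * half P 1 K₀ : ℕ) : ZMod (P.sitesPerDir 0 μ))
    have hz : z ∈ Finset.univ.filter (fun x : HiggsLattice.Site P 0 => (x μ₀).val / half P 1 K₀ < n) := by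
      rw [hΩ]; exact Finset.mem_univ z
    rw [Finset.mem_filter] at hz
    have hval : (z μ₀).val = n * half P 1 K₀ := ZMod.val_cast_of_lt hlt
    have := hz.2
    rw [hval, Nat.mul_div_cancel _ hhalf_pos] at this
    exact lt_irrefl _ this
  · -- the point with all labels `ρ₀` is block-interior: its ball of radius `ρ₀ = margin + (L − 1)` lies in the slab
    have hρn : ∀ μ : Fin d, ρ₀ < P.sitesPerDir 0 μ := by
      intro μ; rw [hsites μ]
      have : ρ₀ * 1 ≤ ρ₀ * (L * K₀) := Nat.mul_le_mul_left _ hLK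
      calc ρ₀ < n := by omega
        _ ≤ n * (L * K₀) := by nlinarith
        _ = L * (K₀ * n) := by ring
        _ ≤ 2 * (L * (K₀ * n)) := by omega
    refine ⟨fun μ => ((ρ₀ : ℕ) : ZMod (P.sitesPerDir 0 μ)), blockInterior_of_ball (k := 1) (le_refl _) fun y hy => ?_⟩
    have hmargin : 2 * rS P 1 K₀ + 2 * half P 1 K₀ * (P.d + 1) + 1 + (P.L ^ 1 - 1) = ρ₀ := by
      rw [hρ₀]; rfl
    rw [hmargin] at hy
    rw [Finset.mem_filter]
    refine ⟨Finset.mem_univ _, ?_⟩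
    have hμ : min ((((ρ₀ : ℕ) : ZMod (P.sitesPerDir 0 μ₀))) - y μ₀).val (y μ₀ - ((ρ₀ : ℕ) : ZMod (P.sitesPerDir 0 μ₀))).val ≤ ρ₀ :=
      (Finset.le_sup (f := fun μ : Fin P.d =>
        min ((((ρ₀ : ℕ) : ZMod (P.sitesPerDir 0 μ))) - y μ).val (y μ - ((ρ₀ : ℕ) : ZMod (P.sitesPerDir 0 μ))).val)
        (Finset.mem_univ μ₀)).trans hy
    have hb : (y μ₀).val ≤ 2 * ρ₀ := val_le_of_min_le (hρn μ₀) hμ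
    calc (y μ₀).val / half P 1 K₀ ≤ (y μ₀).val := Nat.div_le_self _ _
      _ < n := by omega
  · intro z _ μ ν
    simp

end WitnessV

end Literature.MathematicalPhysics.QuantumFieldTheory.Balaban1983to89.B3Ineq212RegularRegion

end
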